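import Summits.ABC.IUTFork.Joshi.AdelicAnsatzDeformation
import Summits.ABC.IUTFork.Joshi.ArithmeticoidsToyModel
import HarnessLib

/-!
# Non-vacuity of the `w`-level gluing certificate `AdelicCurveDatum.DeformationSupply` at an INHABITED deformation datum:
# E-t7's adelic curve datum OF E-t37's toy `ATS2h.toyDatum`, its certificate, and E-t7's inputs there (no arithmetic content)

Test-side support file of the abc-iut cell, block E «type Joshi's construction, test vs S» (rung LADDER-ABC:A2.E; seat abc-iut-E-t57,
batch-3 «[J-IIp] DERIVABLE/SUPPLIER seat»), sequel of `Joshi/AdelicAnsatzDeformation.lean` (this seat, p432924: `DeformationSupply`,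
`ATS2h.DeformationDatum.AnsatzLevel` / `toAdelicCurveDatum` / `supply`) over abc-iut-E-t37's `Joshi/ArithmeticoidsToyModel.lean`
(p432522: `ATS2h.toyDatum`, the one-place degenerate model of the [J-2½] §4–§5 signature, `toy_lActsByFrobeniusPowers`). PURPOSE: p432924
§4 showed the certificate is satisfiable RELATIVE to E-t37's signature; this file instantiates it at E-t37's INHABITED datum, so that
the rows S2/S3 supplied along a `DeformationSupply` (E-t7's `LStarThroughFrobenius`, `[MetrizableSpace 𝒴′]`, Cor. 4.2.3.3) are statements
about a nonempty class (CONVENTIONS §4 vacuity smell). The added `ℚ_p`-level (`AnsatzLevel`) is the TRIVIAL one (one point, primitive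
Ansatz = everything) — deliberately contentless: the honest `ℚ_p`-level instance is the exponent model (`Joshi/PrototypeExponentModel.lean`
/ `Joshi/AdelicAnsatzExponentInstance.lean`, this seat). A model exhibits satisfiability, nothing more; TAKES NO SIDE on [IUTchIII] Cor. 3.12
or on any author; no FACT-LIST row, no new `Prop`, nothing asserted. [folklore]
-/

noncomputable section

namespace Summit.ABC.IUTFork.Joshi.ATS2h

/-- The trivial `ℚ_p`-level over E-t37's toy datum: one bad place (`V^{odd,ss} := univ ⊆ V^non` since `V^arc = ∅`), `ℓ⋆ = 2`, one residue
characteristic, `|Y_{C_p^♭,ℚ_p}| := Unit`, all maps trivial, primitive Ansatz := everything. No arithmetic content. [folklore] -/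
def toyAnsatzLevel : toyDatum.AnsatzLevel where
  oddss := Set.univ
  oddss_nonarch _ _ h := (Set.notMem_empty _ h).elim
  lstar := 2
  one_le_lstar := by norm_num
  P := Unit
  pOf _ := ()
  Y0 _ := Unit
  forget _ _ := ()
  G0 _ := Unit
  g0act _ _ y := y
  res _ _ := ()
  forget_gal _ _ _ := rfl
  frob0 _ := Equiv.refl Unit
  forget_frob _ _ := rfl
  T _ := Unit
  absK _ _ _ := 1
  absK0 _ _ _ := 1
  forget_abs _ _ := rfl
  primAnsatz _ := Set.univ

/-- **E-t7's adelic curve datum OF E-t37's toy deformation datum** ([J-III] §4.1 signature at an inhabited [J-2½] datum). [folklore] -/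
abbrev toyAdelicCurveDatum : AdelicCurveDatum := toyDatum.toAdelicCurveDatum toyAnsatzLevel

/-- **The certificate `DeformationSupply` is INHABITED at an inhabited deformation datum** (all equations `rfl`). [folklore] -/
def toyDeformationSupply : toyAdelicCurveDatum.DeformationSupply toyDatum := toyDatum.supply toyAnsatzLevel

/-- At the toy datum E-t7's input `LStarThroughFrobenius` holds (via S2 from E-t37's `toy_lActsByFrobeniusPowers`) and so does Cor. 4.2.3.3
`AnsatzMetrisable` (via S3) — the supplied rows are about a nonempty class. [folklore] -/
theorem toy_rows : toyAdelicCurveDatum.LStarThroughFrobenius ∧ toyAdelicCurveDatum.AnsatzMetrisable :=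
  toyDatum.toAdelicCurveDatum_lStarThroughFrobenius toyAnsatzLevel toy_lActsByFrobeniusPowers

/-- … hence [J-III] Thm. 4.2.2.1 (3) in the diagonal reading holds at the toy datum (its second input, E-t7's `↔`-Frobenius invariance,
is trivial there: primitive Ansatz = everything). [folklore] -/
theorem toy_ansatzLStarStableDiag : toyAdelicCurveDatum.AnsatzLStarStableDiag :=
  toyDeformationSupply.ansatzLStarStableDiag toy_lActsByFrobeniusPowers
    (fun _ _ => ⟨fun _ => Set.mem_univ _, fun _ => Set.mem_univ _⟩)

/-- Packaged: the adelic curve datum of the toy carries a `DeformationSupply` (the certificate type is inhabited at an inhabited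
deformation datum satisfying [J-2½] Thm. 4.2.3 (4) as typed), and E-t7's `LStarThroughFrobenius`, Cor. 4.2.3.3 and (3)-diagonal hold
there. [folklore] -/
theorem deformationSupply_nonempty :
    Nonempty (toyAdelicCurveDatum.DeformationSupply toyDatum) ∧ toyAdelicCurveDatum.LStarThroughFrobenius ∧
      toyAdelicCurveDatum.AnsatzMetrisable ∧ toyAdelicCurveDatum.AnsatzLStarStableDiag :=
  ⟨⟨toyDeformationSupply⟩, toy_rows.1, toy_rows.2, toy_ansatzLStarStableDiag⟩

end Summit.ABC.IUTFork.Joshi.ATS2h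

end
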